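import Literature.NumberTheory.Automorphic.CaraianiNewtonModularity
import HarnessLib

/-!
# Elliptic curves with rational `j`-invariant over solvable totally real fields are modular:
# base change from `ℚ` (BCDT + Langlands) and twist invariance of modularity

Topic `Literature/NumberTheory/Automorphic` (reciprocity for `GL₂` over totally real fields;
companion of `CaraianiNewtonModularity.lean`, whose rendering `IsModularEllipticCurve K E` of
"`E / K` is modular" — geometric CM, or a weight-zero cuspidal `π` of `GL₂(𝔸_K)` whose
`T_w`-eigenvalue is `a_w(E)` at all but finitely many `w` — we use verbatim, and of
`TotallyRealModularity.lean` / `FreitasLeHungSiksekModularity.lean`). Cite item `wi-36845`, wanted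
by the crux `OddDegreeDoor` (stmt-Langlands-16840) of route `Langlands/HeptagonalTower`: for a
totally real field `K ⊆ ℚ(ζ_{7^{n+1}})⁺` and an elliptic curve `E / K` whose `j`-invariant is
RATIONAL (the non-cuspidal `K`-points of `X₀(15)` being `ℚ`-points), `E` is modular. The printed
argument, in every modularity paper that meets a rational (or small-degree) `j`-invariant, is the
two-step inference

> `E₀/ℚ` is modular (Breuil–Conrad–Diamond–Taylor) ⟹ `E₀ ×_ℚ K` is modular for `K/ℚ` soluble and
> totally real (Langlands' cyclic base change, iterated) ⟹ every quadratic twist of `E₀ ×_ℚ K`,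
> i.e. every `E/K` with `j(E) = j(E₀) ∉ {0, 1728}`, is modular (twist `π ↦ π ⊗ χ`),

and this file vendors exactly these two steps as NAMED FACTS (D-0014) on the tree's carrier, plus
the PROVED packaging the crux consumes.

## What the sources print (quoted from the held texts, read 2026-08-17)

* C. Breuil, B. Conrad, F. Diamond, R. Taylor, *On the modularity of elliptic curves over `ℚ`:
  wild 3-adic exercises*, J. Amer. Math. Soc. 14 (2001) [BCDTJAMS2001], **Theorem A**: "Every
  elliptic curve over `ℚ` is modular."
* R. P. Langlands, *Base change for `GL(2)`*, Ann. of Math. Stud. 96 (1980) [Langlands1980AMS96],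
  Ch. 2, p. 13 (the global liftings for `E/F` cyclic of prime degree `ℓ`): "A) Every `π` has a unique
  lifting. B) If `Π` is isobaric …, in particular cuspidal, then `Π` is a lifting if and only if
  `Π^τ ∼ Π` for all `τ ∈ G(E/F)`. C) … If `π` is cuspidal then `π′` lifts to `Π` if and only if
  `π′ = ω ⊗ π` … F) A quasi-lifting is a lifting." (`Π_v` a lifting of `π_v` at every `v`; at an
  unramified `v` the local lifting is the one dictated by restricting the Langlands class to
  `W_E`, Ch. 1, i.e. Hecke matrix `t_{Π,w} = t_{π,v}^{f(w|v)}`.)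
* J. A. Thorne, *Automorphy of some residually dihedral Galois representations*, Math. Ann. 364
  (2016) [Thorne2016] = arXiv:1504.00994, **Lemma 7.1** (the form in which the iterated theorem is
  used throughout the modularity literature): "Let `F` be a totally real number field, and `F′/F`
  a soluble totally real extension. Let `p` be a prime, and fix an isomorphism `ι : ℚ̄_p → ℂ`.
  • Let `π` be a cuspidal automorphic representation of `GL₂(𝔸_F)` of weight `2`, and suppose that
  `r_ι(π)|_{G_{F′}}` is irreducible. Then there exists a cuspidal automorphic representation
  `π_{F′}` of `GL₂(𝔸_{F′})` of weight `2`, called the base change of `π`, such that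
  `r_ι(π_{F′}) ≅ r_ι(π)|_{G_{F′}}`. • [soluble descent]. *Proof.* The lemma may be deduced from the
  main results of [Lan80], using the argument of [Bar11]."
* N. Freitas, B. V. Le Hung, S. Siksek, *Elliptic curves over real quadratic fields are modular*,
  Invent. Math. 201 (2015) [FreitasLeHungSiksek2015] = arXiv:1310.7088: §2 (p. 9 of the text) "If
  two elliptic curves `E₁`, `E₂` defined over `K`, and having `j`-invariants `≠ 0, 1728` give rise
  to the same `K`-point of `X(H)`, then they have the same `j`-invariant and hence are quadratic
  twists of each other"; §3 (p. 21) "A non-cuspidal point on `X` gives rise to a well-defined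
  `j`-invariant, and when `j ≠ 0, 1728` this determines the underlying elliptic curve up to
  quadratic twists. When we say that a point on `X` is modular, we mean that one (and hence any)
  elliptic curve supporting it is modular"; proof of Thm. 7 (p. 14) "Now by a repeated
  application of cyclic base change results of Langlands [Lan80], it follows that `E/K` is
  modular"; §5 (p. 33) "It follows that any elliptic curve supporting `P` has `j`-invariant
  belonging to `ℚ` and so is modular by [BCDT]."
* J. Box, *Elliptic curves over totally real quartic fields not containing `√5` are modular*,
  Trans. Amer. Math. Soc. 375 (2022) [Box2022] = arXiv:2103.13975, §1.2 (p. 5 of the text): "… or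
  is a quadratic twist `E = E′ ⊗ χ`, where `χ` is a quadratic character and `E′` is an elliptic
  curve defined over a real number field of degree `1` or `2`. In the latter case, `E′` is known to
  be modular. If `E′` corresponds to the Hilbert modular form `𝔣`, then `E` is also modular and
  corresponds to `𝔣 ⊗ χ`."
* S. Yoshikawa, *Modularity of elliptic curves over cyclotomic `ℤ_p`-extensions of real quadratic
  fields*, arXiv:2206.12860 (2022) [Yoshikawa2022], proof of Cor. 3.6 (p. 5): "Therefore, the
  `j`-invariant of `E` is in `F`, and the modularity of `E` follows from [FLHS15, Theorem 1] and the
  cyclic base change [Lan80]." (The requesting crux runs this argument with `F = ℚ`,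
  `F′ ⊆ ℚ(ζ_{7^{n+1}})⁺`, and [BCDT] in place of [FLHS15].)

## What is vendored

* `isModularEllipticCurve_baseChange_rat_of_isSolvable` (**named fact**, step 1 = BCDT Thm. A +
  Langlands Ch. 2 iterated along a composition series of the solvable `Gal(K/ℚ)` = Thorne,
  Lemma 7.1 with `F = ℚ`): for every totally real number field `K`, Galois over `ℚ` with solvable
  Galois group, and every Weierstrass model `E₀` over `ℤ` with `Δ(E₀) ≠ 0`, the base-changed model
  `E₀ ⊗ 𝓞 K` is modular over `K` (`IsModularEllipticCurve K`).
* `isModularEllipticCurve_of_jInvariant_eq` (**named fact**, step 2 = twist invariance, Box §1.2 /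
  FLHS §§2–3): over a totally real number field `K`, two Weierstrass models over `𝓞 K` with
  non-zero discriminants and the SAME `j`-invariant `c₄³/Δ ∉ {0, 1728}` are modular together.
* PROVED: `ratJModel p q` — the integral model `y² = x³ + 3p(1728q - p)q²·x + 2p(1728q - p)²q³`
  of `j`-invariant `p/q` (`ratJModel_c₄`, `ratJModel_Δ`, `ratJModel_Δ_ne_zero`,
  `ratJModel_c₄_pow_three_div_Δ`: `c₄³/Δ = p/q` in every field of characteristic `0`);
  `isModularEllipticCurve_of_jInvariant_eq_ratCast` — the two facts give: `K` totally real,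
  `K/ℚ` Galois and solvable, `E` over `𝓞 K` with `Δ ≠ 0` and `j(E) = j₀ ∈ ℚ ∖ {0, 1728}` ⟹
  `IsModularEllipticCurve K E`; `isGalois_and_isSolvable_of_ringHom_of_isAbelianGalois` (a field
  embedding into an abelian Galois extension of `ℚ` is Galois with solvable group — Mathlib's
  `IsAbelianGalois.of_algHom`) and the crux-shaped
  `isModularEllipticCurve_of_jInvariant_eq_ratCast_of_ringHom` (`K →+* L` with `L/ℚ` abelian,
  e.g. `L = ℚ(ζ_{7^{n+1}})`).

## Rendering and faithfulness

* Carrier. "modular" is Caraiani–Newton's `IsModularEllipticCurve K E` for an integral model `E`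
  over `𝓞 K` (the conclusion of the requesting crux, verbatim): geometric CM
  (`(E.baseChange K).HasCM`) OR a cuspidal automorphic `π` of `GL₂(𝔸_K)` of weight zero
  (`HasWeightZero` = parallel weight `2` = Thorne's "weight 2") with
  `q_w^{1/2}(α_w + β_w) = a_w(E)` (`frobTraceAt`) at all but finitely many finite places `w`. This
  is WEAKER than what the sources give (`r_ι(π_K) ≅ ρ_{E,p}|_{G_K}`, i.e. matching of the full
  Hecke polynomial at every unramified place), never stronger: at a place `w ∤ p·Δ(E)` where `π_K`
  is unramified, the characteristic polynomial of `r_ι(π_K)(Frob_w)` is the Hecke polynomial of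
  `π_{K,w}` (Carayol, Taylor; the tree's `HilbertModularGaloisRep`) and that of `ρ_{E,p}(Frob_w)` is
  `X² - a_w X + q_w` (Silverman V.2.3.1 with VII.5.1: an integral model with `w ∤ Δ` has good
  reduction at `w` and `a_w = q_w + 1 - #E(k_w)`).
* Step 1, why the printed theorems give the fact for EVERY `E₀` and every solvable totally real
  `K`. `Gal(K/ℚ)` solvable ⟹ a tower `ℚ = K₀ ⊂ K₁ ⊂ ⋯ ⊂ K_r = K` of Galois steps of prime degree
  (composition series), along which Langlands Ch. 2 A)–C) is iterated — this is Thorne's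
  Lemma 7.1 (first bullet) with `F = ℚ`, `F′ = K`. Its hypothesis "`r_ι(π)|_{G_K}` irreducible" for
  `π = π(E₀)` (BCDT Thm. A; `r_ι(π) ≅ ρ_{E₀,p}` by Eichler–Shimura) holds whenever `E₀` has no CM
  (Serre 1972, §4.4: open image, so `ρ_{E₀,p}` stays irreducible on every open subgroup
  [SerreInventiones1972]); and when `E₀` has CM the conclusion holds by its FIRST alternative
  (`HasCM` is geometric, hence insensitive to base change). So no printed hypothesis is dropped.
  "Every elliptic curve over `ℚ`" = every Weierstrass model over `ℤ` with `Δ ≠ 0` (each `E₀/ℚ`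
  has one; lang.S28 pattern).
* Step 2, why "same `j ∉ {0,1728}`" is the printed "quadratic twist". Over a field of
  characteristic `0`, elliptic curves with the same `j`-invariant are twists of each other, and for
  `j ≠ 0, 1728` (`Aut = {±1}`) the twists are exactly the quadratic twists `E ⊗ χ_d`
  (Silverman X.5.4 [SilvermanAEC2009]; FLHS §2 as quoted). If `E` is modular via `π` then `E ⊗ χ_d`
  is modular via `π ⊗ (χ_d ∘ det)` (Box §1.2 as quoted; `a_w(E ⊗ χ_d) = χ_d(w) a_w(E)` at good `w`);
  if `E` has CM so does every twist (same `j`). The `j`-invariant of an integral model is written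
  out as `c₄³ / Δ ∈ K` (Silverman III.1, `j = c₄³/Δ`), as in `FLS2015_theorem5`, to avoid an
  `IsElliptic` instance on the base change. `K` totally real is kept because it is the printed
  context (the twist argument itself needs no such restriction).
* NOT derivable inside the tree today (why these are facts, D-0014/D-0026). The tree HAS the
  representation-level base change (lang.S23 `exists_baseChange_cyclic`;
  `ArthurClozel1989_weakLifting_cuspidal`; `baseChange_cyclic_cuspidal`) and character twists of
  automorphic data (`AutomorphicTwistSatake`), but lacks the elliptic-curve side of the dictionary
  needed to descend them to `IsModularEllipticCurve`: BCDT on the automorphic carrier over `ℚ`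
  (the tree's `theoremB` / `CDT_theorem_7_2_4` live on the classical-newform carrier
  `BCDTModularity.IsModular`), the point-count identity `a_w(E₀ ⊗ 𝓞 K) = λ^{f(w|p)} + μ^{f(w|p)}`
  over residue field extensions (Weil; Silverman V.2.3.1), quadratic twists of Weierstrass models
  and their Frobenius traces, and Serre's open image theorem. Each fact below is ONE unit of debt
  with this derivation recorded.
* NOT vendored: soluble DESCENT (Thorne, Lemma 7.1, second bullet; the tree has it for `GL_n` as
  `solubleDescent_isAutomorphic`, `ACCSolubleDescent.lean`); base change to non-solvable totally
  real fields; anything about `X₀(15)`.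

## Design notes

* New leaf file importing only `CaraianiNewtonModularity` (for `IsModularEllipticCurve`,
  `frobTraceAt`, `isCompact_glFiniteIntegralLevel`); nothing imports it.
* Fields are typed `(K : Type) [Field K] [NumberField K] [IsTotallyReal K] [IsGalois ℚ K]
  [IsSolvable (K ≃ₐ[ℚ] K)]` (Mathlib classes; `Algebra ℚ K` is the canonical `ℚ`-algebra structure
  of a characteristic-zero division ring); the base change of `E₀ : WeierstrassCurve ℤ` to `𝓞 K` is
  Mathlib's `WeierstrassCurve.baseChange` along `algebraMap ℤ (𝓞 K)`.
* `ratJModel p q = ⟨0, 0, 0, 3p(1728q-p)q², 2p(1728q-p)²q³⟩` is the `u = q` rescaling of the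
  classical `y² = x³ + 3j(1728-j)x + 2j(1728-j)²` (`j = p/q`): `c₄ = -144·p(1728q-p)q²`,
  `Δ = -2985984·p²(1728q-p)³q⁷`, `c₄³ = -2985984·p³(1728q-p)³q⁶`, so `c₄³/Δ = p/q` exactly.
* Mathlib (grepped): `IsAbelianGalois`, `IsAbelianGalois.of_algHom`, `RingHom.toRatAlgHom`,
  `IsSolvable`, `IsGalois`, `NumberField.IsTotallyReal`, `WeierstrassCurve.map_c₄` / `map_Δ`,
  `Rat.num_div_den`, `Rat.cast_def`, `Rat.num_ne_zero`. No new instances; no `sorry`.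

## References

* [BCDTJAMS2001] C. Breuil, B. Conrad, F. Diamond, R. Taylor, J. Amer. Math. Soc. 14 (2001)
  843–939, Thm. A.
* [Langlands1980AMS96] R. P. Langlands, *Base change for GL(2)*, Ann. of Math. Stud. 96 (1980),
  Ch. 2, pp. 10–13 (local liftings a)–g); global liftings A)–F)). (IAS author's edition read, 2026-08-17.)
* [Thorne2016] J. A. Thorne, Math. Ann. 364 (2016) 589–648, Lemma 7.1 (held: arXiv:1504.00994,
  §7.1, p. 34 of the text).
* [FreitasLeHungSiksek2015] Invent. Math. 201 (2015) 159–206, §2 (p. 9), §3 (p. 21), proof of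
  Thm. 7 (p. 14), §5 (p. 33) of the held text arXiv:1310.7088.
* [Box2022] Trans. Amer. Math. Soc. 375 (2022), §1.2 (p. 5 of the held text arXiv:2103.13975).
* [Yoshikawa2022] arXiv:2206.12860, proof of Cor. 3.6 (p. 5).
* [SerreInventiones1972] J.-P. Serre, Invent. Math. 15 (1972), §4.4 (open image for non-CM `E`).
* [SilvermanAEC2009] J. H. Silverman, *The Arithmetic of Elliptic Curves*, 2nd ed., III.1
  (`j = c₄³/Δ`), V.2.3.1, VII.5.1, X.5.4.
* [CaraianiNewton2023] the carrier `IsModularEllipticCurve` (sibling file).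
-/

open scoped NumberField
open NumberField IsDedekindDomain

noncomputable section

namespace Literature.NumberTheory.Automorphic

/-! ### Step 1: base change of modularity from `ℚ` to solvable totally real fields -/

/-- **Base change of modularity from `ℚ` to a solvable totally real field** (Breuil–Conrad–
Diamond–Taylor, Thm. A, lifted along Langlands' cyclic base change iterated over a composition
series of the solvable Galois group — the first bullet of Thorne 2016, Lemma 7.1, with `F = ℚ`).
For every totally real number field `K` which is Galois over `ℚ` with solvable Galois group
`Gal(K/ℚ)` (in particular every totally real abelian number field, e.g. every subfield of
`ℚ(ζ_N)⁺`), and every elliptic curve over `ℚ` — every Weierstrass model `E₀` over `ℤ` with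
`Δ(E₀) ≠ 0` — the base change `E₀ ⊗ 𝓞 K` is modular over `K` in the sense of Caraiani–Newton
(`IsModularEllipticCurve K`): it has geometric CM, or there is a cuspidal automorphic
representation `π_K` of `GL₂(𝔸_K)` of weight zero (parallel weight `2`) whose `T_w`-eigenvalue is
the trace of Frobenius `a_w(E₀/K)` at all but finitely many finite places `w` of `K`. Printed
derivation (module docstring, "Step 1"): `π_K = BC_{K/ℚ}(π(E₀))` exists and is cuspidal of weight
`2` with `r_ι(π_K) ≅ ρ_{E₀,p}|_{G_K}` when `ρ_{E₀,p}|_{G_K}` is irreducible (Thorne, Lemma 7.1),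
which holds unless `E₀` has CM (Serre's open image theorem), in which case the first alternative
holds. Used in exactly this form by Freitas–Le Hung–Siksek (proof of Thm. 7; §5, p. 33: "has
`j`-invariant belonging to `ℚ` and so is modular by [BCDT]") and by Yoshikawa (proof of Cor. 3.6).
A named fact (D-0014): users take `(h : isModularEllipticCurve_baseChange_rat_of_isSolvable)`.
[cite: Thorne2016, Lemma 7.1] [cite: Langlands1980AMS96, Ch. 2, pp. 10–13 (local liftings a)–g), global liftings A)–F))]
[cite: BCDTJAMS2001, Thm. A] -/
def isModularEllipticCurve_baseChange_rat_of_isSolvable : Prop :=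
  ∀ (K : Type) [Field K] [NumberField K] [IsTotallyReal K] [IsGalois ℚ K]
    [IsSolvable (K ≃ₐ[ℚ] K)] (E₀ : WeierstrassCurve ℤ), E₀.Δ ≠ 0 →
      IsModularEllipticCurve K (E₀.baseChange (𝓞 K))

/-! ### Step 2: twist invariance of modularity (same `j ∉ {0, 1728}`) -/

/-- **Modularity of an elliptic curve over a totally real field depends only on its
`j`-invariant, for `j ∉ {0, 1728}` (twist invariance).** Over a totally real number field `K`, let
`E`, `E'` be Weierstrass models over `𝓞 K` with `Δ(E) ≠ 0`, `Δ(E') ≠ 0` and the same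
`j`-invariant `j(E) = c₄(E)³/Δ(E) = c₄(E')³/Δ(E') = j(E')`, with `j(E) ≠ 0, 1728`. If `E` is
modular (`IsModularEllipticCurve K E`) then so is `E'`. Printed: curves with the same
`j ∉ {0, 1728}` "are quadratic twists of each other" (Freitas–Le Hung–Siksek 2015, §2; Silverman
X.5.4), and "if `E′` corresponds to the Hilbert modular form `𝔣`, then `E = E′ ⊗ χ` is also modular
and corresponds to `𝔣 ⊗ χ`" (Box 2022, §1.2) — on the present carrier: twist `π` by `χ ∘ det`,
`a_w(E ⊗ χ) = χ(w) a_w(E)` at the cofinitely many good places; a CM curve's twists have CM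
(module docstring, "Step 2"). `K` totally real is the printed context. A named fact (D-0014):
users take `(h : isModularEllipticCurve_of_jInvariant_eq)`.
[cite: Box2022, §1.2] [cite: FreitasLeHungSiksek2015, §2 and §3] -/
def isModularEllipticCurve_of_jInvariant_eq : Prop :=
  ∀ (K : Type) [Field K] [NumberField K] [IsTotallyReal K] (E E' : WeierstrassCurve (𝓞 K)),
    E.Δ ≠ 0 → E'.Δ ≠ 0 →
      (algebraMap (𝓞 K) K E.c₄) ^ 3 / algebraMap (𝓞 K) K E.Δ =
          (algebraMap (𝓞 K) K E'.c₄) ^ 3 / algebraMap (𝓞 K) K E'.Δ →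
        (algebraMap (𝓞 K) K E.c₄) ^ 3 / algebraMap (𝓞 K) K E.Δ ≠ 0 →
          (algebraMap (𝓞 K) K E.c₄) ^ 3 / algebraMap (𝓞 K) K E.Δ ≠ 1728 →
            IsModularEllipticCurve K E → IsModularEllipticCurve K E'

/-! ### An integral model of prescribed rational `j`-invariant -/

/-- **The integral model `y² = x³ + 3p(1728q - p)q²·x + 2p(1728q - p)²q³`** over `ℤ`: the
rescaling by `u = q` of the classical curve `y² = x³ + 3j(1728 - j)x + 2j(1728 - j)²` of
`j`-invariant `j = p/q` (non-singular iff `p ≠ 0`, `q ≠ 0`, `p ≠ 1728q`, i.e. `j ∉ {0, 1728, ∞}`;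
`ratJModel_c₄_pow_three_div_Δ`). [folklore] -/
def ratJModel (p q : ℤ) : WeierstrassCurve ℤ :=
  ⟨0, 0, 0, 3 * p * (1728 * q - p) * q ^ 2, 2 * p * (1728 * q - p) ^ 2 * q ^ 3⟩

/-- `c₄` of `ratJModel p q` is `-48 a₄ = -144·p(1728q - p)q²`. [folklore] -/
theorem ratJModel_c₄ (p q : ℤ) : (ratJModel p q).c₄ = -144 * p * (1728 * q - p) * q ^ 2 := by
  simp only [ratJModel, WeierstrassCurve.c₄, WeierstrassCurve.b₂, WeierstrassCurve.b₄]
  ring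

/-- The discriminant of `ratJModel p q` is `-16(4a₄³ + 27a₆²) = -2985984·p²(1728q - p)³q⁷`
(`2985984 = 1728²`). [folklore] -/
theorem ratJModel_Δ (p q : ℤ) :
    (ratJModel p q).Δ = -2985984 * p ^ 2 * (1728 * q - p) ^ 3 * q ^ 7 := by
  simp only [ratJModel, WeierstrassCurve.Δ, WeierstrassCurve.b₂, WeierstrassCurve.b₄,
    WeierstrassCurve.b₆, WeierstrassCurve.b₈]
  ring

/-- `c₄³` of `ratJModel p q` is `-2985984·p³(1728q - p)³q⁶`. [folklore] -/
theorem ratJModel_c₄_pow_three (p q : ℤ) :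
    (ratJModel p q).c₄ ^ 3 = -2985984 * p ^ 3 * (1728 * q - p) ^ 3 * q ^ 6 := by
  rw [ratJModel_c₄]
  ring

/-- `ratJModel p q` is non-singular when `p ≠ 0`, `q ≠ 0` and `p ≠ 1728q`. [folklore] -/
theorem ratJModel_Δ_ne_zero {p q : ℤ} (hp : p ≠ 0) (hq : q ≠ 0) (hpq : p ≠ 1728 * q) :
    (ratJModel p q).Δ ≠ 0 := by
  rw [ratJModel_Δ]
  have h : 1728 * q - p ≠ 0 := sub_ne_zero.2 (Ne.symm hpq)
  simp [h, hp, hq]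

/-- **`ratJModel p q` has `j`-invariant `p/q`:** in every field `L` of characteristic zero,
`c₄³ / Δ = p / q` for the images of `c₄(ratJModel p q)` and `Δ(ratJModel p q)` (when `p ≠ 0`,
`q ≠ 0`, `p ≠ 1728q`). [folklore] -/
theorem ratJModel_c₄_pow_three_div_Δ {p q : ℤ} (hp : p ≠ 0) (hq : q ≠ 0) (hpq : p ≠ 1728 * q)
    (L : Type*) [Field L] [CharZero L] :
    (((ratJModel p q).c₄ : ℤ) : L) ^ 3 / (((ratJModel p q).Δ : ℤ) : L) = (p : L) / (q : L) := by
  have hΔ : (((ratJModel p q).Δ : ℤ) : L) ≠ 0 := by exact_mod_cast ratJModel_Δ_ne_zero hp hq hpq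
  rw [div_eq_div_iff hΔ (by exact_mod_cast hq), ← Int.cast_pow, ratJModel_c₄_pow_three,
    ratJModel_Δ]
  push_cast
  ring

/-! ### The door: rational `j`-invariant over a solvable totally real field -/

/-- **Elliptic curves with rational `j`-invariant `∉ {0, 1728}` over a solvable totally real field
are modular** (from the two named facts of this file). Let `K` be a totally real number field,
Galois over `ℚ` with solvable Galois group, and `E` a Weierstrass model over `𝓞 K` with
`Δ(E) ≠ 0` whose `j`-invariant `c₄³/Δ ∈ K` is the image of a rational number
`j₀ ∉ {0, 1728}`. Then `E` is modular (`IsModularEllipticCurve K E`). Proof: the integral model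
`E₀ = ratJModel j₀.num j₀.den` over `ℤ` has `j`-invariant `j₀` (`ratJModel_c₄_pow_three_div_Δ`),
its base change `E₀ ⊗ 𝓞 K` is modular by `isModularEllipticCurve_baseChange_rat_of_isSolvable`,
and `E` has the same `j ∉ {0,1728}`, so `isModularEllipticCurve_of_jInvariant_eq` applies. This is
the inference "has `j`-invariant belonging to `ℚ` and so is modular by [BCDT]" of
Freitas–Le Hung–Siksek 2015, §5 (p. 33), and of Yoshikawa 2022, proof of Cor. 3.6.
[cite: FreitasLeHungSiksek2015, §5 (p. 33)] -/
theorem isModularEllipticCurve_of_jInvariant_eq_ratCast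
    (hBC : isModularEllipticCurve_baseChange_rat_of_isSolvable)
    (hTw : isModularEllipticCurve_of_jInvariant_eq)
    (K : Type) [Field K] [NumberField K] [IsTotallyReal K] [IsGalois ℚ K]
    [IsSolvable (K ≃ₐ[ℚ] K)] (E : WeierstrassCurve (𝓞 K)) (hΔ : E.Δ ≠ 0)
    (j₀ : ℚ) (hj₀ : j₀ ≠ 0) (hj₁ : j₀ ≠ 1728)
    (hj : (algebraMap (𝓞 K) K E.c₄) ^ 3 / algebraMap (𝓞 K) K E.Δ = (j₀ : K)) :
    IsModularEllipticCurve K E := by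
  -- the integral model `ratJModel p q` over `ℤ` of `j`-invariant `j₀ = p / q`
  set p : ℤ := j₀.num with hp_def
  set q : ℤ := (j₀.den : ℤ) with hq_def
  have hq : q ≠ 0 := by rw [hq_def]; exact_mod_cast j₀.den_nz
  have hp : p ≠ 0 := Rat.num_ne_zero.2 hj₀
  have hpq : p ≠ 1728 * q := by
    intro h
    apply hj₁
    have hq' : (j₀.den : ℚ) ≠ 0 := by exact_mod_cast j₀.den_nz
    calc j₀ = (j₀.num : ℚ) / j₀.den := (Rat.num_div_den j₀).symm
      _ = ((1728 * (j₀.den : ℤ) : ℤ) : ℚ) / j₀.den := by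
          rw [show j₀.num = 1728 * (j₀.den : ℤ) from h]
      _ = 1728 := by push_cast; field_simp
  have hE₀ : (ratJModel p q).Δ ≠ 0 := ratJModel_Δ_ne_zero hp hq hpq
  -- step 1 (named fact `hBC`): the base change of `E₀ / ℚ` to `K` is modular
  have hmod : IsModularEllipticCurve K ((ratJModel p q).baseChange (𝓞 K)) :=
    hBC K (ratJModel p q) hE₀
  -- its `j`-invariant is `j₀`
  have hj' : (algebraMap (𝓞 K) K ((ratJModel p q).baseChange (𝓞 K)).c₄) ^ 3 /
      algebraMap (𝓞 K) K ((ratJModel p q).baseChange (𝓞 K)).Δ = (j₀ : K) := by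
    simp only [WeierstrassCurve.baseChange, WeierstrassCurve.map_c₄, WeierstrassCurve.map_Δ,
      eq_intCast, map_intCast]
    rw [ratJModel_c₄_pow_three_div_Δ hp hq hpq K, hp_def, hq_def, Int.cast_natCast,
      Rat.cast_def]
  have hΔ₀ : ((ratJModel p q).baseChange (𝓞 K)).Δ ≠ 0 := by
    simp only [WeierstrassCurve.baseChange, WeierstrassCurve.map_Δ, eq_intCast]
    exact_mod_cast hE₀
  -- step 2 (named fact `hTw`): same `j ∉ {0, 1728}`
  refine hTw K ((ratJModel p q).baseChange (𝓞 K)) E hΔ₀ hΔ (hj'.trans hj.symm) ?_ ?_ hmod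
  · rw [hj']; exact_mod_cast hj₀
  · rw [hj']; exact_mod_cast hj₁

/-- A field `K` of characteristic zero that embeds into an abelian Galois extension `L` of `ℚ`
(e.g. `L = ℚ(ζ_N)`) is Galois over `ℚ` with solvable (indeed abelian) Galois group — Mathlib's
`IsAbelianGalois.of_algHom` and "abelian ⟹ solvable". [folklore] -/
theorem isGalois_and_isSolvable_of_ringHom_of_isAbelianGalois
    (K L : Type*) [Field K] [CharZero K] [Field L] [CharZero L] [IsAbelianGalois ℚ L]
    (f : K →+* L) : IsGalois ℚ K ∧ IsSolvable (K ≃ₐ[ℚ] K) := by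
  haveI : IsAbelianGalois ℚ K := IsAbelianGalois.of_algHom f.toRatAlgHom
  open scoped IsMulCommutative in exact ⟨inferInstance, inferInstance⟩

/-- **The door in the shape of the requesting crux** (`OddDegreeDoor`, route
`Langlands/HeptagonalTower`): a totally real number field `K` embedding into an abelian Galois
extension `L` of `ℚ` (there: `L = ℚ(ζ_{7^{n+1}})`, `K ⊆ L⁺`), and `E` over `𝓞 K` with `Δ(E) ≠ 0`
and `j(E) = j₀ ∈ ℚ ∖ {0, 1728}`: then `E` is modular, granted the two named facts.
[cite: FreitasLeHungSiksek2015, §5 (p. 33)] -/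
theorem isModularEllipticCurve_of_jInvariant_eq_ratCast_of_ringHom
    (hBC : isModularEllipticCurve_baseChange_rat_of_isSolvable)
    (hTw : isModularEllipticCurve_of_jInvariant_eq)
    (K : Type) [Field K] [NumberField K] [IsTotallyReal K]
    (L : Type*) [Field L] [CharZero L] [IsAbelianGalois ℚ L] (f : K →+* L)
    (E : WeierstrassCurve (𝓞 K)) (hΔ : E.Δ ≠ 0) (j₀ : ℚ) (hj₀ : j₀ ≠ 0) (hj₁ : j₀ ≠ 1728)
    (hj : (algebraMap (𝓞 K) K E.c₄) ^ 3 / algebraMap (𝓞 K) K E.Δ = (j₀ : K)) :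
    IsModularEllipticCurve K E := by
  obtain ⟨hG, hS⟩ := isGalois_and_isSolvable_of_ringHom_of_isAbelianGalois K L f
  exact isModularEllipticCurve_of_jInvariant_eq_ratCast hBC hTw K E hΔ j₀ hj₀ hj₁ hj

end Literature.NumberTheory.Automorphic

end
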